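import Mathlib
import Summits.NavierStokesRegularity.NavierStokesRegularity.Theorems.LerayQuarterDissipationFiniteDissipationLiouvilleVorticityLThreeTools
import Summits.NavierStokesRegularity.NavierStokesRegularity.Theorems.LerayQuarterDissipationFiniteDissipationLiouvilleSmallDissipationGapSharper
import HarnessLib

/-!
# Crux `FiniteDissipationLiouville` (stmt-NavierStokesRegularity-22144): the MIXED `(C, K)` region —
# an explicit lens of the crux's own parameter plane beyond the two strips `{C < 1}`, `{θ(K)⁴ < 64/27}`
# (file 1/2: the mixed stretching bound and the mixed Liouville theorem)

Theorems file of route `LerayQuarterDissipation` (lead prover g17; `--supports` the crux; portrait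
fact for the registered stub `stub_envelopeCriticalLiouville` of skeleton `Lines/birth.lean`).
Navier–Stokes regularity is NOT proved by anything here; no summit is.

`𝒟_{C,K}`: Type-I ancient mild fields `V` in the KNSS gauge (`IsTypeIAncientMild C V`, in
particular `√(−t)‖V(t,x)‖ ≤ C`) obeying Leray's quarter-rate dissipation law
`∫‖DV(t)‖² ≤ K/√(−t)`; `θ(K) = √(max K 0)·(√K_S)³`, `K_S` Mathlib's Gagliardo–Nirenberg–Sobolev
constant `SNormLESNormFDerivOfEqConst ℝ³ volume 2`. Before this file the EXPLICIT part of the proved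
region of the crux in its own `(C, K)` plane was the union of two strips: `C < 1` (T31⁗, the
stretching term of the localised similarity-enstrophy budget priced by `‖U‖ ≤ C`, Young's
inequality quadratic in the weight) and `θ(K)⁴ < 64/27` (`…SmallDissipationGapSharper`, priced by
Ladyzhenskaya + `‖DU‖₂ ≤ √K`, Young's inequality QUARTIC in the weight); `C ≤ 1 + ε(K)` beyond is
ineffective (compactness, `…ThresholdOne`). Because the two pricings are homogeneous of DIFFERENT
degrees in their Young weights, a convex combination `λ : (1−λ)` of them with separately optimised
weights beats the union:

* `two_mul_stretching_le_mixed` — the mixed four-term stretching bound on `R ≥ 1`: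
  `2∫φ_R²⟪DUΩ,Ω⟫ ≤ [2λμ + (1−λ)·3(1+δ)/(2κ)]·D_R + [λC²/(2μ) + (1−λ)κ³θ⁴/2]·Z_R + (c/R)·I_{2R}`
  (`…VorticityAmplitude.two_mul_integral_sqCutoff_stretching_le_typeI` with Young weight `μ`, plus
  `…SmallDissipationGap.two_mul_integral_sqCutoff_stretching_le_weighted` with `m⁴ = κθ`);
* **`eq_zero_of_mixed`** — **a member of `𝒟_{C,K}` vanishes identically as soon as, for some
  `0 ≤ λ ≤ 1`, `μ, κ, δ > 0` and `T ≥ θ(K)⁴`, `2λμ + (1−λ)·3(1+δ)/(2κ) ≤ 2` (the dissipation is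
  not overspent) and `λC²/μ + (1−λ)κ³T < 1` (contraction of the global enstrophy)**; `λ = 1`,
  `μ = 1` is `C < 1`; `λ = 0`, `κ = 3(1+δ)/4` is `θ⁴ < 64/27·(1+δ)⁻³`;
* `eq_zero_of_mixed_hull` — the same in convex-hull form: `λa + (1−λ)η ≤ 1` and
  `λC²/a + (1−λ)(27/64)θ⁴/η³ < 1` for some `0 ≤ λ ≤ 1`, `a, η > 0`;
* `not_singular_of_mixed`, `mixed_ge_one_of_singular` — regularity form / PORTRAIT: the hypothetical
  singular profile's pair `(C, θ(K_c)⁴)` lies outside the whole lens (numerically the lens is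
  `1 ≤ C < 2/√3 ≈ 1.155`, `64/27 ≤ θ⁴ < 4`, e.g. `θ⁴ < 2.90` at `C = 1.02`, `< 2.59` at `C = 1.05`,
  `< 2.41` at `C = 1.1`);
* (file 2/2 `…MixedRegionExplicit`: closed-form and numerical points of the lens — `C ≤ 1 ∧ θ⁴ < 4`,
  `C ≤ 21/20 ∧ θ⁴ ≤ 5/2`, `C ≤ 11/10 ∧ θ⁴ ≤ 12/5` force `V ≡ 0` — and the enlarged explicit proved
  region of the crux).

HONEST FRAMING. Explicit necessary conditions on the HYPOTHETICAL singular profile; the lens is thin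
(a few percent in `C`, a factor `≤ 1.69` in `θ⁴`) and its boundary is neither claimed sharp nor
analysed for attainment; Mathlib's `K_S` is not the sharp Sobolev constant. This is the first
EXPLICIT piece of the proved region with `C > 1`; nothing is removed from the catalogued DSS wall
(`∀ c > 1, TypeIDSSLiouville c`, NECESSARY for the crux by `…Hardness`); the verdict of the line is
unchanged (FRONTIER). Nothing here bears on Navier–Stokes regularity or blow-up.

References: Koch–Nadirashvili–Seregin–Šverák, Acta Math. 203 (2009) §4 (the class); J. Leray, Acta
Math. 63 (1934) §20 (scaling of the dissipation); O. A. Ladyzhenskaya's inequality; folklore energy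
method.
-/

noncomputable section

set_option linter.dupNamespace false

namespace Summit.NavierStokesRegularity.NavierStokesRegularity.Theorems.FiniteDissipationLiouville.MixedRegion

open MeasureTheory Set Filter Topology Metric InnerProductSpace Function Real
open scoped RealInnerProductSpace ContDiff ENNReal Laplacian
open Literature.Analysis Literature.Analysis.FluidPDE
open Summit.NavierStokesRegularity.NavierStokesRegularity.Theorems
open Summit.NavierStokesRegularity.NavierStokesRegularity.Theorems.GaussianGap
open Summit.NavierStokesRegularity.NavierStokesRegularity.Theorems.SimilarityEnstrophy
open Summit.NavierStokesRegularity.NavierStokesRegularity.Theorems.SmallDissipationGap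
open Summit.NavierStokesRegularity.NavierStokesRegularity.Theorems.FiniteDissipationLiouville.VorticityAmplitude
open Summit.NavierStokesRegularity.NavierStokesRegularity.Theorems.FiniteDissipationLiouville.VorticityLThree

variable {C : ℝ} {V : ℝ → (EuclideanSpace ℝ (Fin 3)) → (EuclideanSpace ℝ (Fin 3))}

/-! ### The mixed stretching bound -/

section Stretching

/-- **The mixed four-term stretching bound (`R ≥ 1`).** Let `V` be a KNSS-gauge Type-I field with
constant `C` whose similarity slices obey `∫‖DU(s)‖² ≤ K_U`, and put `θ = √K_U·(√K_S)³ > 0`. For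
`0 ≤ λ ≤ 1`, `μ, κ, δ > 0` and `R ≥ 1`:
`2∫φ_R²⟪DUΩ,Ω⟫ ≤ (2λμ + (1−λ)·3(1+δ)/(2κ))·∫φ_R²|∇Ω|²_F + (λC²/(2μ) + (1−λ)κ³θ⁴/2)·∫φ_R²‖Ω‖²
  + ((λ·4Cc₁ + (1−λ)·3(1+δ⁻¹)c₁²/(2κ))/R)·∫_{B̄_{2R}}‖Ω‖²` — the convex combination of the
`C`-priced bound (Young weight `μ`) and the Ladyzhenskaya bound with weights `m⁴ = κθ`, `δ`
(`(c₁/R)² ≤ c₁²/R` for `R ≥ 1`). [folklore energy method; Ladyzhenskaya's inequality] -/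
theorem two_mul_stretching_le_mixed (hV : IsTypeIAncientMild C V) {c₁ : ℝ}
    (hc₁ : ∀ R : ℝ, 0 < R → ∀ y : EuclideanSpace ℝ (Fin 3),
      ‖fderiv ℝ (fun z : EuclideanSpace ℝ (Fin 3) => smoothTransition (2 - ‖z‖ ^ 2 / R ^ 2)) y‖ ≤
        c₁ / R)
    {KU : ℝ} (hint : ∀ s : ℝ, Integrable (fun y => ‖fderiv ℝ (lerayOrbit V s) y‖ ^ 2))
    (hKU : ∀ s : ℝ, ∫ y, ‖fderiv ℝ (lerayOrbit V s) y‖ ^ 2 ≤ KU)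
    (hθ : 0 < Real.sqrt KU * Real.sqrt (SNormLESNormFDerivOfEqConst (EuclideanSpace ℝ (Fin 3))
          (volume : Measure (EuclideanSpace ℝ (Fin 3))) 2 : ℝ) ^ 3)
    {lam μ κ δ : ℝ} (hlam0 : 0 ≤ lam) (hlam1 : lam ≤ 1) (hμ : 0 < μ) (hκ : 0 < κ) (hδ : 0 < δ)
    {R : ℝ} (hR : 1 ≤ R) (s : ℝ) :
    2 * (∫ y, smoothTransition (2 - ‖y‖ ^ 2 / R ^ 2) ^ 2 *
        ⟪fderiv ℝ (lerayOrbit V s) y (lerayVorticity V s y), lerayVorticity V s y⟫) ≤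
      (2 * lam * μ + (1 - lam) * (3 * (1 + δ) / (2 * κ))) *
          (∫ y, smoothTransition (2 - ‖y‖ ^ 2 / R ^ 2) ^ 2 *
            frobeniusNormSq (fderiv ℝ (lerayVorticity V s) y)) +
        (lam * C ^ 2 / (2 * μ) + (1 - lam) * (κ ^ 3 * (Real.sqrt KU * Real.sqrt (SNormLESNormFDerivOfEqConst (EuclideanSpace ℝ (Fin 3))
          (volume : Measure (EuclideanSpace ℝ (Fin 3))) 2 : ℝ) ^ 3) ^ 4 / 2)) *
          (∫ y, smoothTransition (2 - ‖y‖ ^ 2 / R ^ 2) ^ 2 * ‖lerayVorticity V s y‖ ^ 2) +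
        (lam * (4 * C * c₁) + (1 - lam) * (3 * (1 + δ⁻¹) * c₁ ^ 2 / (2 * κ))) / R *
          ∫ y in closedBall (0 : EuclideanSpace ℝ (Fin 3)) (2 * R), ‖lerayVorticity V s y‖ ^ 2 := by
  have hC : 0 ≤ C := hV.nonneg
  have hR0 : 0 < R := lt_of_lt_of_le one_pos hR
  set θ : ℝ := Real.sqrt KU * Real.sqrt (SNormLESNormFDerivOfEqConst (EuclideanSpace ℝ (Fin 3))
          (volume : Measure (EuclideanSpace ℝ (Fin 3))) 2 : ℝ) ^ 3 with hθdef
  -- the Young weight `m` with `m⁴ = κ θ`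
  set q : ℝ := κ * θ with hq
  have hqpos : 0 < q := mul_pos hκ hθ
  set m : ℝ := Real.sqrt (Real.sqrt q) with hm
  have hmpos : 0 < m := Real.sqrt_pos.2 (Real.sqrt_pos.2 hqpos)
  have hm4 : m ^ 4 = q := by
    rw [show m ^ 4 = (m ^ 2) ^ 2 by ring, hm, Real.sq_sqrt (Real.sqrt_nonneg _),
      Real.sq_sqrt hqpos.le]
  have hm12 : m ^ 12 = q ^ 3 := by rw [show m ^ 12 = (m ^ 4) ^ 3 by ring, hm4]
  -- the two pricings
  have h1 := two_mul_integral_sqCutoff_stretching_le_typeI hV hc₁ hR0 s hμ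
  have h2 := two_mul_integral_sqCutoff_stretching_le_weighted hV hc₁ hR0 s (hint s) (hKU s) hδ hmpos
  rw [← hθdef] at h2
  set S := 2 * (∫ y, smoothTransition (2 - ‖y‖ ^ 2 / R ^ 2) ^ 2 *
      ⟪fderiv ℝ (lerayOrbit V s) y (lerayVorticity V s y), lerayVorticity V s y⟫) with hSdef
  set D := ∫ y, smoothTransition (2 - ‖y‖ ^ 2 / R ^ 2) ^ 2 *
      frobeniusNormSq (fderiv ℝ (lerayVorticity V s) y) with hDdef
  set Z := ∫ y, smoothTransition (2 - ‖y‖ ^ 2 / R ^ 2) ^ 2 * ‖lerayVorticity V s y‖ ^ 2 with hZdef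
  set I := ∫ y in closedBall (0 : EuclideanSpace ℝ (Fin 3)) (2 * R), ‖lerayVorticity V s y‖ ^ 2
    with hIdef
  have hI0 : 0 ≤ I := integral_nonneg fun y => sq_nonneg _
  have hZ0 : 0 ≤ Z := integral_nonneg fun y => mul_nonneg (sq_nonneg _) (sq_nonneg _)
  have hD0 : 0 ≤ D := integral_nonneg fun y => mul_nonneg (sq_nonneg _) (frobeniusNormSq_nonneg _)
  -- rewrite the coefficients of the Ladyzhenskaya bound with `m⁴ = κθ`
  have hcoefZ : θ * m ^ 12 / 2 = κ ^ 3 * θ ^ 4 / 2 := by rw [hm12, hq]; ring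
  have hcoefD : 3 * θ / (2 * m ^ 4) * (1 + δ) = 3 * (1 + δ) / (2 * κ) := by
    rw [hm4, hq]; field_simp
  have hcoefI : 3 * θ / (2 * m ^ 4) * (1 + δ⁻¹) = 3 * (1 + δ⁻¹) / (2 * κ) := by
    rw [hm4, hq]; field_simp
  rw [hcoefZ, hcoefD, hcoefI] at h2
  -- `(c₁/R)² ≤ c₁²/R` for `R ≥ 1`
  have hc₁R : (c₁ / R) ^ 2 ≤ c₁ ^ 2 / R := by
    rw [div_pow, div_le_div_iff₀ (by positivity) hR0]
    have : c₁ ^ 2 * R ≤ c₁ ^ 2 * R ^ 2 := by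
      apply mul_le_mul_of_nonneg_left _ (sq_nonneg _)
      nlinarith
    linarith
  have h2' : S ≤ κ ^ 3 * θ ^ 4 / 2 * Z + 3 * (1 + δ) / (2 * κ) * D +
      3 * (1 + δ⁻¹) / (2 * κ) * (c₁ ^ 2 / R) * I := by
    have hδi : 0 ≤ 3 * (1 + δ⁻¹) / (2 * κ) := by positivity
    have := mul_le_mul_of_nonneg_right (mul_le_mul_of_nonneg_left hc₁R hδi) hI0
    linarith [h2]
  -- the convex combination
  have hsplit : S = lam * S + (1 - lam) * S := by ring
  have hl1 : lam * S ≤ lam * (2 * μ * D + C ^ 2 / (2 * μ) * Z + 4 * C * (c₁ / R) * I) :=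
    mul_le_mul_of_nonneg_left h1 hlam0
  have hl2 : (1 - lam) * S ≤ (1 - lam) * (κ ^ 3 * θ ^ 4 / 2 * Z + 3 * (1 + δ) / (2 * κ) * D +
      3 * (1 + δ⁻¹) / (2 * κ) * (c₁ ^ 2 / R) * I) :=
    mul_le_mul_of_nonneg_left h2' (by linarith)
  have e : lam * (2 * μ * D + C ^ 2 / (2 * μ) * Z + 4 * C * (c₁ / R) * I) +
      (1 - lam) * (κ ^ 3 * θ ^ 4 / 2 * Z + 3 * (1 + δ) / (2 * κ) * D +
        3 * (1 + δ⁻¹) / (2 * κ) * (c₁ ^ 2 / R) * I) =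
      (2 * lam * μ + (1 - lam) * (3 * (1 + δ) / (2 * κ))) * D +
        (lam * C ^ 2 / (2 * μ) + (1 - lam) * (κ ^ 3 * θ ^ 4 / 2)) * Z +
        (lam * (4 * C * c₁) + (1 - lam) * (3 * (1 + δ⁻¹) * c₁ ^ 2 / (2 * κ))) / R * I := by
    field_simp
    ring
  linarith

end Stretching

/-! ### The mixed Liouville theorem -/

section Liouville

/-- **THE MIXED `(C, K)` LIOUVILLE THEOREM.** Let `V ∈ 𝒟_{C,K}` (KNSS-gauge Type-I field with
constant `C` and the law `∫‖DV(t)‖² ≤ K/√(−t)`), `θ(K)⁴ = (√(max K 0)·(√K_S)³)⁴ ≤ T`. If for some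
`0 ≤ λ ≤ 1` and `μ, κ, δ > 0` the dissipation is not overspent, `2λμ + (1−λ)·3(1+δ)/(2κ) ≤ 2`, and
the enstrophy contracts, `λC²/μ + (1−λ)κ³T < 1`, then `V ≡ 0` on `t < 0`. Proof: the mixed
stretching bound feeds the four-term budget `…VorticityLThree.integral_sq_norm_lerayVorticity_le_of_forall_one_le`,
whose contraction ratio is `λC²/μ + (1−λ)κ³θ⁴ < 1`; iterating kills the global similarity enstrophy,
so every slice is curl- and divergence-free and bounded, hence constant, and the gauge kills
constants. (`θ = 0`, i.e. `K ≤ 0`, is the tree's small-dissipation rung.) [folklore energy method] -/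
theorem eq_zero_of_mixed (hV : IsTypeIAncientMild C V) {K : ℝ}
    (hK : ∀ t : ℝ, t < 0 → ∫⁻ x, ‖fderiv ℝ (V t) x‖ₑ ^ 2 ≤ ENNReal.ofReal (K / Real.sqrt (-t)))
    {T lam μ κ δ : ℝ} (hT : (Real.sqrt (max K 0) * Real.sqrt (SNormLESNormFDerivOfEqConst (EuclideanSpace ℝ (Fin 3))
          (volume : Measure (EuclideanSpace ℝ (Fin 3))) 2 : ℝ) ^ 3) ^ 4 ≤ T)
    (hlam0 : 0 ≤ lam) (hlam1 : lam ≤ 1) (hμ : 0 < μ) (hκ : 0 < κ) (hδ : 0 < δ)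
    (H1 : 2 * lam * μ + (1 - lam) * (3 * (1 + δ) / (2 * κ)) ≤ 2)
    (H2 : lam * C ^ 2 / μ + (1 - lam) * κ ^ 3 * T < 1) :
    ∀ t < 0, ∀ x, V t x = 0 := by
  have hC : 0 ≤ C := hV.nonneg
  set θ : ℝ := Real.sqrt (max K 0) * Real.sqrt (SNormLESNormFDerivOfEqConst (EuclideanSpace ℝ (Fin 3))
          (volume : Measure (EuclideanSpace ℝ (Fin 3))) 2 : ℝ) ^ 3 with hθdef
  have hθ0 : 0 ≤ θ := by positivity
  -- `θ = 0`: the small-dissipation rung of the tree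
  rcases hθ0.eq_or_lt with hθz | hθpos
  · exact eq_zero_of_small_dissipation_sharper hV hK (by rw [← hθdef, ← hθz]; norm_num)
  have hΩi := fun σ => integrable_sq_norm_lerayVorticity hV hK σ
  have hDU := fun s => integrable_sq_norm_fderiv_lerayOrbit hV hK s
  obtain ⟨c₁, hc₁0, hc₁⟩ :=
    exists_norm_fderiv_smoothTransition_cutoff_le (E := (EuclideanSpace ℝ (Fin 3)))
  set M : ℝ := ‖curlCLM‖ ^ 2 * max K 0 with hMdef
  -- the four-term stretching bound
  set a : ℝ := lam * C ^ 2 / (2 * μ) + (1 - lam) * (κ ^ 3 * θ ^ 4 / 2) with hadef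
  set c : ℝ := lam * (4 * C * c₁) + (1 - lam) * (3 * (1 + δ⁻¹) * c₁ ^ 2 / (2 * κ)) with hcdef
  have h1lam : 0 ≤ 1 - lam := by linarith
  have ha : 0 ≤ a := by positivity
  have hc : 0 ≤ c := by positivity
  have hstr : ∀ σ : ℝ, ∀ R : ℝ, 1 ≤ R →
      2 * (∫ y, smoothTransition (2 - ‖y‖ ^ 2 / R ^ 2) ^ 2 *
        ⟪fderiv ℝ (lerayOrbit V σ) y (lerayVorticity V σ y), lerayVorticity V σ y⟫) ≤
        2 * (∫ y, smoothTransition (2 - ‖y‖ ^ 2 / R ^ 2) ^ 2 *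
            frobeniusNormSq (fderiv ℝ (lerayVorticity V σ) y)) +
          a * (∫ y, smoothTransition (2 - ‖y‖ ^ 2 / R ^ 2) ^ 2 * ‖lerayVorticity V σ y‖ ^ 2) +
          0 * (∫ y, ‖lerayVorticity V σ y‖ ^ 2) +
          c / R * ∫ y in closedBall (0 : EuclideanSpace ℝ (Fin 3)) (2 * R), ‖lerayVorticity V σ y‖ ^ 2 := by
    intro σ R hR
    have h := two_mul_stretching_le_mixed hV hc₁ (KU := max K 0) (fun s => (hDU s).1)
      (fun s => (hDU s).2) (by rw [← hθdef]; exact hθpos) hlam0 hlam1 hμ hκ hδ hR σ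
    rw [← hθdef, ← hadef, ← hcdef] at h
    have hD0 : 0 ≤ ∫ y, smoothTransition (2 - ‖y‖ ^ 2 / R ^ 2) ^ 2 *
        frobeniusNormSq (fderiv ℝ (lerayVorticity V σ) y) :=
      integral_nonneg fun y => mul_nonneg (sq_nonneg _) (frobeniusNormSq_nonneg _)
    have hDle := mul_le_mul_of_nonneg_right H1 hD0
    rw [zero_mul, add_zero]
    linarith
  -- the contraction ratio
  have hr1 : 2 * (a + 0) < 1 := by
    have hθT : κ ^ 3 * θ ^ 4 ≤ κ ^ 3 * T := mul_le_mul_of_nonneg_left hT (by positivity)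
    have : (1 - lam) * (κ ^ 3 * θ ^ 4) ≤ (1 - lam) * (κ ^ 3 * T) :=
      mul_le_mul_of_nonneg_left hθT h1lam
    have e : 2 * (a + 0) = lam * C ^ 2 / μ + (1 - lam) * (κ ^ 3 * θ ^ 4) := by
      rw [hadef]; field_simp; ring
    rw [e]
    nlinarith
  have hr0 : 0 ≤ 2 * (a + 0) := by positivity
  have hiter : ∀ n : ℕ, ∀ s, ∫ y, ‖lerayVorticity V s y‖ ^ 2 ≤ (2 * (a + 0)) ^ n * M := by
    intro n
    induction n with
    | zero => intro s; rw [pow_zero, one_mul]; exact (hΩi s).2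
    | succ n ih =>
        intro s
        calc ∫ y, ‖lerayVorticity V s y‖ ^ 2 ≤ 2 * (a + 0) * ((2 * (a + 0)) ^ n * M) :=
              integral_sq_norm_lerayVorticity_le_of_forall_one_le hV hK ha le_rfl hc hstr ih s
          _ = (2 * (a + 0)) ^ (n + 1) * M := by ring
  have hlim : Tendsto (fun n : ℕ => (2 * (a + 0)) ^ n * M) atTop (𝓝 (0 * M)) :=
    (tendsto_pow_atTop_nhds_zero_of_lt_one hr0 hr1).mul_const M
  rw [zero_mul] at hlim
  -- `Ω ≡ 0`
  have hΩ0 : ∀ s y, lerayVorticity V s y = 0 := by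
    intro s
    have hcΩ : Continuous (lerayVorticity V s) :=
      (signedBudget_contDiff_lerayVorticity_slice hV s (n := 1)).continuous
    have hE0 : ∫ y, ‖lerayVorticity V s y‖ ^ 2 ≤ 0 := ge_of_tendsto' hlim fun n => hiter n s
    have hE : ∫ y, ‖lerayVorticity V s y‖ ^ 2 = 0 :=
      le_antisymm hE0 (integral_nonneg fun y => sq_nonneg _)
    have hae : (fun y => ‖lerayVorticity V s y‖ ^ 2) =ᵐ[volume] 0 :=
      (integral_eq_zero_iff_of_nonneg (fun y => sq_nonneg _) (hΩi s).1).1 hE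
    have hev : (fun y => ‖lerayVorticity V s y‖ ^ 2) = fun _ => (0 : ℝ) :=
      ((hcΩ.norm.pow 2).ae_eq_iff_eq (μ := volume) continuous_const).1 hae
    intro y
    have hy := congrFun hev y
    have : ‖lerayVorticity V s y‖ = 0 := pow_eq_zero_iff (n := 2) (by norm_num) |>.1 hy
    exact norm_eq_zero.1 this
  -- `V ≡ 0`
  have hcurl : ∀ t < 0, ∀ x, curl (V t) x = 0 := by
    intro t ht x
    set s : ℝ := -Real.log (-t) with hs
    have hts : -Real.exp (-s) = t := by
      rw [hs, neg_neg, Real.exp_log (neg_pos.2 ht), neg_neg]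
    have h := hΩ0 s ((Real.exp (-s / 2))⁻¹ • x)
    rw [lerayVorticity_apply, curl_lerayOrbit, smul_smul,
      mul_inv_cancel₀ (Real.exp_pos _).ne', one_smul, hts, smul_eq_zero] at h
    exact h.resolve_left (Real.exp_pos _).ne'
  have hconst : ∀ t < 0, ∀ x, V t x = V t 0 := fun t ht x =>
    eq_of_curl_eq_zero_of_isDivFree_of_bounded ((hV.contDiff_slice ht).of_le (by norm_cast))
      (hcurl t ht) (hV.isDivFree ht) (fun z => hV.norm_le ht z) x 0
  exact fun t ht x => hV.eq_zero_of_slice_const (b := fun t => V t 0) hconst ht x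

/-- **Regularity form of the mixed theorem**, in the quantifier shape of the crux: under its
hypotheses NO member is singular at the apex. [folklore energy method] -/
theorem not_singular_of_mixed (hV : IsTypeIAncientMild C V) {K : ℝ}
    (hK : ∀ t : ℝ, t < 0 → ∫⁻ x, ‖fderiv ℝ (V t) x‖ₑ ^ 2 ≤ ENNReal.ofReal (K / Real.sqrt (-t)))
    {T lam μ κ δ : ℝ} (hT : (Real.sqrt (max K 0) * Real.sqrt (SNormLESNormFDerivOfEqConst (EuclideanSpace ℝ (Fin 3))
          (volume : Measure (EuclideanSpace ℝ (Fin 3))) 2 : ℝ) ^ 3) ^ 4 ≤ T)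
    (hlam0 : 0 ≤ lam) (hlam1 : lam ≤ 1) (hμ : 0 < μ) (hκ : 0 < κ) (hδ : 0 < δ)
    (H1 : 2 * lam * μ + (1 - lam) * (3 * (1 + δ) / (2 * κ)) ≤ 2)
    (H2 : lam * C ^ 2 / μ + (1 - lam) * κ ^ 3 * T < 1) :
    ¬ (∀ r > 0, ∀ M : ℝ, ∃ t ∈ Set.Ioo (-(r ^ 2)) (0 : ℝ),
        ∃ x ∈ Metric.ball (0 : EuclideanSpace ℝ (Fin 3)) r, M < ‖V t x‖) := by
  intro hsing
  obtain ⟨t, ht, x, -, hM⟩ := hsing 1 one_pos 0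
  rw [eq_zero_of_mixed hV hK hT hlam0 hlam1 hμ hκ hδ H1 H2 t ht.2 x, norm_zero] at hM
  exact lt_irrefl _ hM

/-- **PORTRAIT: the singular profile lies outside the whole mixed lens.** If `V ∈ 𝒟_{C,K}` is
singular at the apex, then for all `0 ≤ λ ≤ 1`, `μ, κ, δ > 0` with `2λμ + (1−λ)·3(1+δ)/(2κ) ≤ 2`:
`λC²/μ + (1−λ)κ³θ(K)⁴ ≥ 1`. [folklore energy method] -/
theorem mixed_ge_one_of_singular (hV : IsTypeIAncientMild C V) {K : ℝ}
    (hK : ∀ t : ℝ, t < 0 → ∫⁻ x, ‖fderiv ℝ (V t) x‖ₑ ^ 2 ≤ ENNReal.ofReal (K / Real.sqrt (-t)))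
    (hsing : ∀ r > 0, ∀ M : ℝ, ∃ t ∈ Set.Ioo (-(r ^ 2)) (0 : ℝ),
        ∃ x ∈ Metric.ball (0 : EuclideanSpace ℝ (Fin 3)) r, M < ‖V t x‖)
    {lam μ κ δ : ℝ} (hlam0 : 0 ≤ lam) (hlam1 : lam ≤ 1) (hμ : 0 < μ) (hκ : 0 < κ) (hδ : 0 < δ)
    (H1 : 2 * lam * μ + (1 - lam) * (3 * (1 + δ) / (2 * κ)) ≤ 2) :
    1 ≤ lam * C ^ 2 / μ + (1 - lam) * κ ^ 3 * (Real.sqrt (max K 0) * Real.sqrt (SNormLESNormFDerivOfEqConst (EuclideanSpace ℝ (Fin 3))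
          (volume : Measure (EuclideanSpace ℝ (Fin 3))) 2 : ℝ) ^ 3) ^ 4 := by
  by_contra h
  push Not at h
  exact not_singular_of_mixed hV hK le_rfl hlam0 hlam1 hμ hκ hδ H1 h hsing

/-- **The mixed region in convex-hull form.** Let `V ∈ 𝒟_{C,K}` and `θ(K)⁴ ≤ T`. If for some
`0 ≤ λ ≤ 1` and `a, η > 0` with `λa + (1−λ)η ≤ 1` one has
`λC²/a + (1−λ)·(27/64)·T/η³ < 1`, then `V ≡ 0` (take `μ = a`, `κ = 3(1+δ)/(4η)` with `δ` small:
`κ³T = (27/64)(1+δ)³T/η³`). The curve `λ ↦` optimum of this condition is the boundary of the lens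
described in the module docstring; `λ = 1`: `C² < a ≤ 1`; `λ = 0`: `(27/64)θ⁴ < η³ ≤ 1`.
[folklore energy method] -/
theorem eq_zero_of_mixed_hull (hV : IsTypeIAncientMild C V) {K : ℝ}
    (hK : ∀ t : ℝ, t < 0 → ∫⁻ x, ‖fderiv ℝ (V t) x‖ₑ ^ 2 ≤ ENNReal.ofReal (K / Real.sqrt (-t)))
    {T lam a η : ℝ} (hT : (Real.sqrt (max K 0) * Real.sqrt (SNormLESNormFDerivOfEqConst (EuclideanSpace ℝ (Fin 3))
          (volume : Measure (EuclideanSpace ℝ (Fin 3))) 2 : ℝ) ^ 3) ^ 4 ≤ T)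
    (hlam0 : 0 ≤ lam) (hlam1 : lam ≤ 1) (ha : 0 < a) (hη : 0 < η)
    (hD : lam * a + (1 - lam) * η ≤ 1)
    (hZ : lam * C ^ 2 / a + (1 - lam) * (27 / 64) * T / η ^ 3 < 1) :
    ∀ t < 0, ∀ x, V t x = 0 := by
  have hT0 : 0 ≤ T := le_trans (by positivity) hT
  have h1lam : 0 ≤ 1 - lam := by linarith
  -- the slack and the product-rule weight `δ`
  set y : ℝ := (1 - lam) * (27 / 64) * T / η ^ 3 with hy
  have hy0 : 0 ≤ y := by positivity
  set g : ℝ := 1 - (lam * C ^ 2 / a + y) with hg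
  have hgpos : 0 < g := by rw [hg]; linarith
  set δ : ℝ := min 1 (g / (14 * (y + 1))) with hδdef
  have hδpos : 0 < δ := lt_min one_pos (by positivity)
  have hδ1 : δ ≤ 1 := min_le_left _ _
  have hδg : 7 * δ * y < g := by
    have h1 : δ ≤ g / (14 * (y + 1)) := min_le_right _ _
    have h2 : δ * (14 * (y + 1)) ≤ g := by
      have := mul_le_mul_of_nonneg_right h1 (by positivity : (0:ℝ) ≤ 14 * (y + 1))
      rwa [div_mul_cancel₀ _ (by positivity)] at this
    nlinarith
  have hcube : (1 + δ) ^ 3 ≤ 1 + 7 * δ := by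
    have hδ2 : δ ^ 2 ≤ δ := by nlinarith
    have hδ3 : δ ^ 3 ≤ δ := by nlinarith
    nlinarith
  -- parameters
  set κ : ℝ := 3 * (1 + δ) / (4 * η) with hκ
  have hκpos : 0 < κ := by positivity
  refine eq_zero_of_mixed hV hK hT hlam0 hlam1 ha hκpos hδpos ?_ ?_
  · -- dissipation: `2λa + (1−λ)·3(1+δ)/(2κ) = 2λa + 2(1−λ)η ≤ 2`
    have e : 3 * (1 + δ) / (2 * κ) = 2 * η := by
      rw [hκ]; field_simp; ring
    rw [e]
    nlinarith
  · -- contraction: `κ³T = (27/64)(1+δ)³ T/η³`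
    have e : (1 - lam) * κ ^ 3 * T = y * (1 + δ) ^ 3 := by
      rw [hκ, hy]; field_simp; ring
    rw [e]
    have : y * (1 + δ) ^ 3 ≤ y * (1 + 7 * δ) := mul_le_mul_of_nonneg_left hcube hy0
    nlinarith

end Liouville

end Summit.NavierStokesRegularity.NavierStokesRegularity.Theorems.FiniteDissipationLiouville.MixedRegion

end
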